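import Mathlib.LinearAlgebra.Matrix.Kronecker
import Mathlib.LinearAlgebra.Matrix.ConjTranspose
import Literature.MathematicalPhysics.QuantumLattice.MatrixProductStates
import HarnessLib

/-!
# Blocked (multi-site) MPS tensors: the operator-weighted Heisenberg map factorises site by site

Family `hubbard` / tensor networks (topic `MathematicalPhysics/QuantumLattice`). Companion of
`MatrixProductStates` (`transferOp`), `OpenMPSProductExpectation` and `MPSCoarseGrainingMaps`.

Fix a commutative star-ring `R` (in applications `ℂ`, or `ℤ` with the trivial star for exact integer
twins of a certificate). For a site tensor `A = (A^s)_{s : σ}` of RECTANGULAR matrices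
`A^s : Matrix β γ R` (left bond `β`, right bond `γ`), a one-site operator `O : Matrix σ σ R` and a
left-bond matrix `M : Matrix β β R`, the **operator-weighted Heisenberg (dual transfer) map** is

  `opSandwich A O M = Σ_{s t} O_{st} · (A^s)ᴴ M A^t : Matrix γ γ R`

(Schollwöck 2011 §4.2.1, the "transfer operator with operator insertion" `E_O = Σ O^{σσ'} A^{σ*} ⊗ A^{σ'}`
read as a map on bond matrices; at `O = 1` it is the dual `Φ(M) = Σ_s (A^s)ᴴ M A^s` of the transfer
operator `𝔼` of `MatrixProductStates`, see `opSandwich_one` / `transferOp_eq_opSandwich`).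
**Blocking** two neighbouring sites with tensors `A` (left, bonds `α → β`) and `B` (right, bonds
`β → γ`) gives the two-site tensor on the product alphabet `σ × τ`,

  `consTensor A B (s, u) = A^s B^u : Matrix α γ R`

(Perez-Garcia–Verstraete–Wolf–Cirac 2007 §2: "blocking" sites into one with physical dimension
`|σ|·|τ|`). The one identity of this file is the **zipper / sweep factorisation**

  `opSandwich (consTensor A B) (O ⊗ₖ P) M = opSandwich B P (opSandwich A O M)`
  (`opSandwich_consTensor_kronecker`):

the Heisenberg map of a blocked tensor weighted by a PRODUCT operator is the composition of the
one-site maps, innermost = leftmost site. Iterating it (re-associating `σ × (τ × υ)` with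
`opSandwich_reindex`) evaluates expectation-type contractions of an `N`-site block in `N` cheap steps
instead of one step on an alphabet of size `q^N` — the standard cost reduction of every DMRG/MPS code
(Schollwöck 2011 §4.2.1 "it is essential to get the order of contractions right"). Also recorded:
bilinearity in `O` and in `M`, reindexing invariance, the adjoint rule `(opSandwich A O M)ᴴ =
opSandwich A Oᴴ Mᴴ`, and compatibility with entrywise star-compatible ring maps (`Matrix.map`), which
transports an identity computed over `ℤ` to `ℂ`.

Provenance: the cited sections define the objects (`E_O`, blocked tensors) and use these identities
as routine; the Lean statements and proofs are ours (standard finite-sum algebra, tagged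
`[folklore]` with the locating citation). Pure finite-sum matrix algebra; no gauge/isometry
condition on the tensors; nothing here is a claim
about any Hamiltonian. Deliberately NOT here: dependent-length (`Fin N`-indexed bond dimensions)
iterations — users iterate the two-factor lemma — and any identification of `σ × τ` with `Fin (q·q')`
(apply `opSandwich_reindex` with `finProdFinEquiv`).

## References
* U. Schollwöck, *The density-matrix renormalization group in the age of matrix product states*,
  Ann. Phys. 326 (2011) 96–192, §4.2.1 (transfer operators with operator insertions; iterative
  contraction order). [cite: Schollwoeck2011AnnPhys, §4.2.1]
* D. Perez-Garcia, F. Verstraete, M. M. Wolf, J. I. Cirac, Quantum Inf. Comput. 7 (2007) 401, §2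
  (MPS, blocking of sites) and §2.1 (the transfer operator `𝔼`). [cite: PerezGarciaVerstraeteWolfCiracQIC2007, §2]
-/

namespace Literature.MathematicalPhysics.QuantumLattice

open Matrix
open scoped Kronecker

section General

variable {R : Type*} [CommRing R] [StarRing R]
variable {σ τ σ' α β γ : Type*} [Fintype σ] [Fintype τ] [Fintype σ'] [Fintype α] [Fintype β]

/-- The **operator-weighted Heisenberg map** of a (rectangular) site tensor `A = (A^s)_s`,
`A^s : Matrix β γ R`: `opSandwich A O M = Σ_{s t} O_{st} · (A^s)ᴴ M A^t`, taking a left-bond matrix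
`M : Matrix β β R` to a right-bond matrix. Schollwöck (2011) §4.2.1 (transfer operator with the
one-site operator `O` inserted, dual/Heisenberg reading). [cite: Schollwoeck2011AnnPhys, §4.2.1] -/
def opSandwich (A : σ → Matrix β γ R) (O : Matrix σ σ R) (M : Matrix β β R) : Matrix γ γ R :=
  ∑ s, ∑ t, O s t • ((A s)ᴴ * M * A t)

/-- **Blocking two sites.** The two-site tensor of a left tensor `A` (bonds `α → β`) and a right
tensor `B` (bonds `β → γ`) on the product alphabet: `consTensor A B (s, u) = A^s B^u`.
Perez-Garcia–Verstraete–Wolf–Cirac (2007) §2 (blocking). [cite: PerezGarciaVerstraeteWolfCiracQIC2007, §2] -/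
def consTensor (A : σ → Matrix α β R) (B : τ → Matrix β γ R) : σ × τ → Matrix α γ R :=
  fun p => A p.1 * B p.2

/-- Unfolding `opSandwich`. [folklore]
[cite: Schollwoeck2011AnnPhys, §4.2.1] -/
theorem opSandwich_def (A : σ → Matrix β γ R) (O : Matrix σ σ R) (M : Matrix β β R) :
    opSandwich A O M = ∑ s, ∑ t, O s t • ((A s)ᴴ * M * A t) := rfl

omit [StarRing R] [Fintype σ] [Fintype τ] [Fintype α] in
/-- Unfolding `consTensor`. [folklore]
[cite: Schollwoeck2011AnnPhys, §4.2.1] -/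
@[simp]
theorem consTensor_apply (A : σ → Matrix α β R) (B : τ → Matrix β γ R) (p : σ × τ) :
    consTensor A B p = A p.1 * B p.2 := rfl

omit [Fintype σ] [Fintype τ] [Fintype α] in
/-- The adjoint of a blocked matrix: `(A^s B^u)ᴴ = (B^u)ᴴ (A^s)ᴴ`. [folklore]
[cite: Schollwoeck2011AnnPhys, §4.2.1] -/
theorem conjTranspose_consTensor (A : σ → Matrix α β R) (B : τ → Matrix β γ R) (p : σ × τ) :
    (consTensor A B p)ᴴ = (B p.2)ᴴ * (A p.1)ᴴ :=
  conjTranspose_mul _ _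

/-- At `O = 1` the operator-weighted map is the plain Heisenberg (dual transfer) map
`Φ(M) = Σ_s (A^s)ᴴ M A^s`. Schollwöck (2011) §4.2.1. [cite: Schollwoeck2011AnnPhys, §4.2.1] -/
theorem opSandwich_one [DecidableEq σ] (A : σ → Matrix β γ R) (M : Matrix β β R) :
    opSandwich A 1 M = ∑ s, (A s)ᴴ * M * A s := by
  unfold opSandwich
  refine Finset.sum_congr rfl fun s _ => ?_
  rw [Finset.sum_eq_single s]
  · rw [one_apply_eq, one_smul]
  · intro t _ hts
    rw [one_apply_ne' hts, zero_smul]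
  · intro h
    exact absurd (Finset.mem_univ s) h

/-- Additivity in the inserted operator. [folklore]
[cite: Schollwoeck2011AnnPhys, §4.2.1] -/
theorem opSandwich_add (A : σ → Matrix β γ R) (O O' : Matrix σ σ R) (M : Matrix β β R) :
    opSandwich A (O + O') M = opSandwich A O M + opSandwich A O' M := by
  simp only [opSandwich, Matrix.add_apply, add_smul, Finset.sum_add_distrib]

/-- Homogeneity in the inserted operator. [folklore]
[cite: Schollwoeck2011AnnPhys, §4.2.1] -/
theorem opSandwich_smul (A : σ → Matrix β γ R) (c : R) (O : Matrix σ σ R) (M : Matrix β β R) :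
    opSandwich A (c • O) M = c • opSandwich A O M := by
  simp only [opSandwich, Matrix.smul_apply, smul_eq_mul, mul_smul, Finset.smul_sum]

/-- `opSandwich A 0 M = 0`. [folklore]
[cite: Schollwoeck2011AnnPhys, §4.2.1] -/
@[simp]
theorem opSandwich_zero (A : σ → Matrix β γ R) (M : Matrix β β R) : opSandwich A 0 M = 0 := by
  simp only [opSandwich, Matrix.zero_apply, zero_smul, Finset.sum_const_zero]

/-- Finite additivity in the inserted operator: `Σ_i c_i O_i` inserted = `Σ_i c_i ·` (each inserted).
[folklore]
[cite: Schollwoeck2011AnnPhys, §4.2.1] -/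
theorem opSandwich_sum_smul {ι : Type*} (s : Finset ι) (A : σ → Matrix β γ R) (c : ι → R)
    (O : ι → Matrix σ σ R) (M : Matrix β β R) :
    opSandwich A (∑ i ∈ s, c i • O i) M = ∑ i ∈ s, c i • opSandwich A (O i) M := by
  classical
  induction s using Finset.induction_on with
  | empty => simp
  | insert i s hi ih => rw [Finset.sum_insert hi, Finset.sum_insert hi, opSandwich_add,
      opSandwich_smul, ih]

/-- Additivity in the bond matrix. [folklore]
[cite: Schollwoeck2011AnnPhys, §4.2.1] -/
theorem opSandwich_add_right (A : σ → Matrix β γ R) (O : Matrix σ σ R) (M M' : Matrix β β R) :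
    opSandwich A O (M + M') = opSandwich A O M + opSandwich A O M' := by
  simp only [opSandwich, Matrix.mul_add, Matrix.add_mul, smul_add, Finset.sum_add_distrib]

/-- Homogeneity in the bond matrix. [folklore]
[cite: Schollwoeck2011AnnPhys, §4.2.1] -/
theorem opSandwich_smul_right (A : σ → Matrix β γ R) (O : Matrix σ σ R) (c : R) (M : Matrix β β R) :
    opSandwich A O (c • M) = c • opSandwich A O M := by
  simp only [opSandwich, Matrix.mul_smul, Matrix.smul_mul, smul_smul, mul_comm c, Finset.smul_sum]

/-- `opSandwich A O 0 = 0`. [folklore]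
[cite: Schollwoeck2011AnnPhys, §4.2.1] -/
@[simp]
theorem opSandwich_zero_right (A : σ → Matrix β γ R) (O : Matrix σ σ R) : opSandwich A O 0 = 0 := by
  simp only [opSandwich, Matrix.mul_zero, Matrix.zero_mul, smul_zero, Finset.sum_const_zero]

/-- **Reindexing invariance**: relabelling the physical alphabet along an equivalence `e : σ' ≃ σ`
(tensor `A ∘ e`, operator `O.submatrix e e`) does not change the map. [folklore]
[cite: Schollwoeck2011AnnPhys, §4.2.1] -/
theorem opSandwich_reindex (e : σ' ≃ σ) (A : σ → Matrix β γ R) (O : Matrix σ σ R) (M : Matrix β β R) :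
    opSandwich (fun i => A (e i)) (O.submatrix e e) M = opSandwich A O M := by
  unfold opSandwich
  simp only [submatrix_apply]
  rw [e.sum_comp (fun s => ∑ t', O s (e t') • ((A s)ᴴ * M * A (e t')))]
  exact Finset.sum_congr rfl fun s _ => e.sum_comp (fun t => O s t • ((A s)ᴴ * M * A t))

/-- **Adjoint rule**: `(opSandwich A O M)ᴴ = opSandwich A Oᴴ Mᴴ`; in particular the map takes
Hermitian `M` to Hermitian matrices when `O` is Hermitian. [folklore]
[cite: Schollwoeck2011AnnPhys, §4.2.1] -/
theorem conjTranspose_opSandwich (A : σ → Matrix β γ R) (O : Matrix σ σ R) (M : Matrix β β R) :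
    (opSandwich A O M)ᴴ = opSandwich A Oᴴ Mᴴ := by
  unfold opSandwich
  rw [conjTranspose_sum, Finset.sum_comm]
  refine Finset.sum_congr rfl fun s _ => ?_
  rw [conjTranspose_sum]
  refine Finset.sum_congr rfl fun t _ => ?_
  rw [conjTranspose_smul, conjTranspose_mul, conjTranspose_mul, conjTranspose_conjTranspose,
    conjTranspose_apply, Matrix.mul_assoc]

/-- **The sweep (zipper) factorisation.** For the blocked tensor of `A` (left site) and `B` (right
site) and a product insertion `O ⊗ₖ P`,
`Σ_{(s,u),(t,v)} O_{st} P_{uv} (A^s B^u)ᴴ M (A^t B^v) = Σ_{u v} P_{uv} (B^u)ᴴ (Σ_{s t} O_{st} (A^s)ᴴ M A^t) B^v`: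
the two-site map is the right-site map applied to the left-site image. Schollwöck (2011) §4.2.1
(iterated evaluation of contractions / transfer operators). [cite: Schollwoeck2011AnnPhys, §4.2.1] -/
theorem opSandwich_consTensor_kronecker (A : σ → Matrix α β R) (B : τ → Matrix β γ R)
    (O : Matrix σ σ R) (P : Matrix τ τ R) (M : Matrix α α R) :
    opSandwich (consTensor A B) (O ⊗ₖ P) M = opSandwich B P (opSandwich A O M) := by
  unfold opSandwich
  rw [Fintype.sum_prod_type_right]
  refine Finset.sum_congr rfl fun u _ => ?_
  simp_rw [Fintype.sum_prod_type_right (f := fun p' : σ × τ => (O ⊗ₖ P) _ p' • _)]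
  rw [Finset.sum_comm]
  refine Finset.sum_congr rfl fun v _ => ?_
  rw [Matrix.mul_sum, Matrix.sum_mul, Finset.smul_sum]
  refine Finset.sum_congr rfl fun s _ => ?_
  rw [Matrix.mul_sum, Matrix.sum_mul, Finset.smul_sum]
  refine Finset.sum_congr rfl fun t _ => ?_
  rw [kroneckerMap_apply, consTensor_apply, consTensor_apply, conjTranspose_mul, Matrix.mul_smul,
    Matrix.smul_mul, smul_smul, mul_comm (P u v)]
  simp only [Matrix.mul_assoc]

/-- The sweep factorisation with the identity inserted on the right site:
`opSandwich (consTensor A B) (O ⊗ₖ 1) M = Σ_u (B^u)ᴴ (opSandwich A O M) B^u`. [folklore]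
[cite: Schollwoeck2011AnnPhys, §4.2.1] -/
theorem opSandwich_consTensor_kronecker_one [DecidableEq τ] (A : σ → Matrix α β R) (B : τ → Matrix β γ R)
    (O : Matrix σ σ R) (M : Matrix α α R) :
    opSandwich (consTensor A B) (O ⊗ₖ (1 : Matrix τ τ R)) M =
      ∑ u, (B u)ᴴ * opSandwich A O M * B u := by
  rw [opSandwich_consTensor_kronecker, opSandwich_one]

/-- The sweep factorisation with the identity inserted on the left site:
`opSandwich (consTensor A B) (1 ⊗ₖ P) M = opSandwich B P (Σ_s (A^s)ᴴ M A^s)`. [folklore]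
[cite: Schollwoeck2011AnnPhys, §4.2.1] -/
theorem opSandwich_consTensor_one_kronecker [DecidableEq σ] (A : σ → Matrix α β R) (B : τ → Matrix β γ R)
    (P : Matrix τ τ R) (M : Matrix α α R) :
    opSandwich (consTensor A B) ((1 : Matrix σ σ R) ⊗ₖ P) M =
      opSandwich B P (∑ s, (A s)ᴴ * M * A s) := by
  rw [opSandwich_consTensor_kronecker, opSandwich_one]

/-- The plain Heisenberg map of a blocked tensor is the composition of the one-site Heisenberg maps:
`Σ_{(s,u)} (A^s B^u)ᴴ M (A^s B^u) = Σ_u (B^u)ᴴ (Σ_s (A^s)ᴴ M A^s) B^u`.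
Perez-Garcia–Verstraete–Wolf–Cirac (2007) §2.1 (the transfer operator of blocked sites is the
composite of the transfer operators). [cite: PerezGarciaVerstraeteWolfCiracQIC2007, §2.1] -/
theorem opSandwich_consTensor_one [DecidableEq σ] [DecidableEq τ] (A : σ → Matrix α β R) (B : τ → Matrix β γ R) (M : Matrix α α R) :
    opSandwich (consTensor A B) 1 M = ∑ u, (B u)ᴴ * (∑ s, (A s)ᴴ * M * A s) * B u := by
  rw [← one_kronecker_one, opSandwich_consTensor_kronecker_one, opSandwich_one]

omit [StarRing R] [Fintype σ] [Fintype τ] [Fintype α] in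
/-- **Associativity of blocking** (three sites): `(A^s B^u) C^w = A^s (B^u C^w)` along
`Equiv.prodAssoc`; with `opSandwich_reindex` this re-brackets an `N`-site block so that the two-site
sweep lemma can be iterated. [folklore] [cite: PerezGarciaVerstraeteWolfCiracQIC2007, §2] -/
theorem consTensor_assoc {υ δ : Type*} [Fintype γ] (A : σ → Matrix α β R) (B : τ → Matrix β γ R)
    (C : υ → Matrix γ δ R) (p : (σ × τ) × υ) :
    consTensor (consTensor A B) C p = consTensor A (consTensor B C) (Equiv.prodAssoc σ τ υ p) := by
  simp only [consTensor_apply, Equiv.prodAssoc_apply, Matrix.mul_assoc]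

/-- **Three-site sweep**: for the block `A^s (B^u C^w)` and a product insertion `O ⊗ₖ (P ⊗ₖ Q)` the
weighted Heisenberg map is the composite of the three one-site maps (the two-site lemma, twice).
Schollwöck (2011) §4.2.1. [cite: Schollwoeck2011AnnPhys, §4.2.1] -/
theorem opSandwich_consTensor_consTensor_kronecker {υ δ : Type*} [Fintype υ] [Fintype γ]
    (A : σ → Matrix α β R) (B : τ → Matrix β γ R) (C : υ → Matrix γ δ R) (O : Matrix σ σ R)
    (P : Matrix τ τ R) (Q : Matrix υ υ R) (M : Matrix α α R) :
    opSandwich (consTensor A (consTensor B C)) (O ⊗ₖ (P ⊗ₖ Q)) M =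
      opSandwich C Q (opSandwich B P (opSandwich A O M)) := by
  rw [opSandwich_consTensor_kronecker, opSandwich_consTensor_kronecker]

end General

section Map

variable {R S : Type*} [CommRing R] [StarRing R] [CommRing S] [StarRing S]
variable {σ τ α β γ : Type*} [Fintype σ] [Fintype β]

omit [StarRing R] [StarRing S] in
/-- Entrywise maps commute with finite sums of matrices (additivity of `Matrix.map`). [folklore] -/
private theorem matrix_map_sum {ι m n : Type*} (s : Finset ι) (X : ι → Matrix m n R) (f : R →+* S) :
    (∑ i ∈ s, X i).map f = ∑ i ∈ s, (X i).map f := by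
  ext i j
  simp only [map_apply, Matrix.sum_apply, map_sum]

omit [StarRing R] [StarRing S] in
/-- Entrywise ring maps take `c • X` to `f c • X.map f`. [folklore] -/
private theorem matrix_map_smul {m n : Type*} (c : R) (X : Matrix m n R) (f : R →+* S) :
    (c • X).map f = f c • X.map f := by
  ext i j
  simp only [map_apply, Matrix.smul_apply, smul_eq_mul, map_mul]

/-- **Change of scalars.** A ring map `f : R →+* S` commuting with `star` (e.g. `ℤ → ℂ`) transports
`opSandwich` entrywise: an identity for an integer twin holds verbatim after casting. [folklore]
[cite: Schollwoeck2011AnnPhys, §4.2.1] -/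
theorem map_opSandwich (f : R →+* S) (hf : ∀ x, f (star x) = star (f x)) (A : σ → Matrix β γ R)
    (O : Matrix σ σ R) (M : Matrix β β R) :
    (opSandwich A O M).map f = opSandwich (fun s => (A s).map f) (O.map f) (M.map f) := by
  unfold opSandwich
  rw [matrix_map_sum]
  refine Finset.sum_congr rfl fun s _ => ?_
  rw [matrix_map_sum]
  refine Finset.sum_congr rfl fun t _ => ?_
  rw [matrix_map_smul, Matrix.map_mul, Matrix.map_mul, Matrix.conjTranspose_map f hf, map_apply]

omit [StarRing R] [StarRing S] [Fintype σ] in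
/-- Change of scalars for blocked tensors: `(A^s B^u).map f = (A^s.map f) (B^u.map f)`. [folklore]
[cite: Schollwoeck2011AnnPhys, §4.2.1] -/
theorem map_consTensor (f : R →+* S) (A : σ → Matrix α β R) (B : τ → Matrix β γ R) (p : σ × τ) :
    (consTensor A B p).map f = consTensor (fun s => (A s).map f) (fun u => (B u).map f) p := by
  simp only [consTensor_apply, Matrix.map_mul]

end Map

section Complex

variable {q D : ℕ}

/-- The transfer operator `𝔼(X) = Σ_i A^i X (A^i)ᴴ` of `MatrixProductStates` is the `O = 1`
operator-weighted map of the ADJOINT tensor `(A^i)ᴴ` (Schrödinger vs Heisenberg reading).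
Perez-Garcia–Verstraete–Wolf–Cirac (2007) §2.1. [cite: PerezGarciaVerstraeteWolfCiracQIC2007, §2.1] -/
theorem transferOp_eq_opSandwich (A : MPSTensor q D) (X : Matrix (Fin D) (Fin D) ℂ) :
    transferOp A X = opSandwich (fun i => (A i)ᴴ) 1 X := by
  rw [transferOp_apply, opSandwich_one]
  simp only [conjTranspose_conjTranspose]

end Complex

section Sums

variable {R : Type*} [CommRing R] [StarRing R]
variable {σ β γ : Type*} [Fintype σ] [Fintype β]

/-- Finite additivity in the inserted operator (no coefficients): `Σ_i O_i` inserted = `Σ_i` (each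
inserted). [folklore] [cite: Schollwoeck2011AnnPhys, §4.2.1] -/
theorem opSandwich_sum {ι : Type*} (s : Finset ι) (A : σ → Matrix β γ R) (O : ι → Matrix σ σ R)
    (M : Matrix β β R) :
    opSandwich A (∑ i ∈ s, O i) M = ∑ i ∈ s, opSandwich A (O i) M := by
  classical
  induction s using Finset.induction_on with
  | empty => simp
  | insert i s hi ih => rw [Finset.sum_insert hi, Finset.sum_insert hi, opSandwich_add, ih]

/-- Finite additivity in the bond matrix. [folklore] [cite: Schollwoeck2011AnnPhys, §4.2.1] -/
theorem opSandwich_sum_right {ι : Type*} (s : Finset ι) (A : σ → Matrix β γ R) (O : Matrix σ σ R)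
    (M : ι → Matrix β β R) :
    opSandwich A O (∑ i ∈ s, M i) = ∑ i ∈ s, opSandwich A O (M i) := by
  classical
  induction s using Finset.induction_on with
  | empty => simp
  | insert i s hi ih => rw [Finset.sum_insert hi, Finset.sum_insert hi, opSandwich_add_right, ih]

/-- `opSandwich A (-O) M = -opSandwich A O M`. [folklore] [cite: Schollwoeck2011AnnPhys, §4.2.1] -/
theorem opSandwich_neg (A : σ → Matrix β γ R) (O : Matrix σ σ R) (M : Matrix β β R) :
    opSandwich A (-O) M = -opSandwich A O M := by
  rw [← neg_one_smul R O, opSandwich_smul, neg_one_smul]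

/-- `opSandwich A (O - O') M = opSandwich A O M - opSandwich A O' M`. [folklore]
[cite: Schollwoeck2011AnnPhys, §4.2.1] -/
theorem opSandwich_sub (A : σ → Matrix β γ R) (O O' : Matrix σ σ R) (M : Matrix β β R) :
    opSandwich A (O - O') M = opSandwich A O M - opSandwich A O' M := by
  rw [sub_eq_add_neg, opSandwich_add, opSandwich_neg, ← sub_eq_add_neg]

/-- `opSandwich A O (-M) = -opSandwich A O M`. [folklore] [cite: Schollwoeck2011AnnPhys, §4.2.1] -/
theorem opSandwich_neg_right (A : σ → Matrix β γ R) (O : Matrix σ σ R) (M : Matrix β β R) :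
    opSandwich A O (-M) = -opSandwich A O M := by
  rw [← neg_one_smul R M, opSandwich_smul_right, neg_one_smul]

/-- `opSandwich A O (M - M') = opSandwich A O M - opSandwich A O M'`. [folklore]
[cite: Schollwoeck2011AnnPhys, §4.2.1] -/
theorem opSandwich_sub_right (A : σ → Matrix β γ R) (O : Matrix σ σ R) (M M' : Matrix β β R) :
    opSandwich A O (M - M') = opSandwich A O M - opSandwich A O M' := by
  rw [sub_eq_add_neg, opSandwich_add_right, opSandwich_neg_right, ← sub_eq_add_neg]

/-- An `if`-guarded insertion: `opSandwich A (if p then O else 0) M = if p then opSandwich A O M else 0`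
(how graph-adjacency guards in a Hamiltonian pass through the sweep). [folklore]
[cite: Schollwoeck2011AnnPhys, §4.2.1] -/
theorem opSandwich_ite_zero (p : Prop) [Decidable p] (A : σ → Matrix β γ R) (O : Matrix σ σ R)
    (M : Matrix β β R) :
    opSandwich A (if p then O else 0) M = if p then opSandwich A O M else 0 := by
  split_ifs
  · rfl
  · exact opSandwich_zero A M

end Sums

end Literature.MathematicalPhysics.QuantumLattice
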